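import Mathlib
import HarnessLib
import Summits.ResolutionOfSingularities.ResolutionOfSingularities.Theorems.WildQuotientsWildQuotientResolutionTranslationInvariants

/-!
# S2 F5a (polynomial half): twisted translation invariants and their reflection to the `s`-side
(crux stmt-ResolutionOfSingularities-15640 `WildQuotients.WildQuotientResolution`, line `Sketch`;
chain w45c post-V5 programme S2, design `L/res-L1-w45c-lead-1/S2-DESIGN.md` v1.1 §7 (7.7) F5,
res-L1-w45c-plan-1 RULING 2026-08-27T17:07:17Z (R4) «normality-free graded one-variable route».
[OURS · L1 W4.5c] — NOT a statement of the manuscript. Lead prover res-L1-w45c-lead-1.)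

The ONE-VARIABLE problem behind CLAIM P: over a commutative ring `A` of characteristic `p`, an
element `f = P(s)/u^m` of `A[s][u⁻¹]`, `u = 1 − s^{p−1}`, satisfies `f(s/(1+s)) = (1+s)^N f(s)` iff
(clearing `u^m`, `σu = u/(1+s)^p`) the polynomial identity `Φ_{pm}(P) = (1+s)^N · P` holds, where
`Φ_D(P) := ∑ᵢ Pᵢ sⁱ (1+s)^{D−i}` (`ConductorOne.twistSubst`). Reflecting at level `pm + N`
(`z = 1/s`) turns it into `z^N · P̃(z+1) = (z+1)^N · P̃(z)` for `P̃ = reflect (pm) P`, whose solutions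
are `P̃ = z^N · Q(z^p − z)` by the tree's Artin–Schreier lemma B1
`ToricExit.fixedPoints_translate` (`…TranslationInvariants.lean`, p486502); reflecting back gives the
NORMAL FORM `P = ∑_d q_d · s^{pm − N − pd} · (1 − s^{p−1})^d` (`pd + N ≤ pm`). Contents:

* reflection calculus: `reflect_reflect'`, `reflect_add_level`, `reflect_one_add_X_pow`,
  `reflect_twistSubst` (`reflect D (Φ_D P) = (reflect D P).comp (X+1)`), `reflect_artinSchreier_pow`
  (`reflect (p·d) ((X^p − X)^d) = (1 − X^{p−1})^d`);
* `exists_eq_X_pow_mul_of_twisted_translate` — `X^N · R.comp (X+1) = (X+1)^N · R ⇒ R = X^N · Q(X^p − X)`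
  with the degree bound `N + p · natDegree Q ≤ natDegree R` (for `Q ≠ 0`);
* **`exists_normalForm_of_twistSubst_eq`** — the normal form above from `Φ_{pm}(P) = (1+X)^N · P`.

The transport to `k[s][u⁻¹]` and the negative-twist case (multiply by `u^{−j}`) are
`…ConductorOneOneVariable.lean`.
-/

-- single-problem summit: the doubled namespace component `ResolutionOfSingularities` is forced
set_option linter.dupNamespace false

noncomputable section

open Polynomial

namespace Summit.ResolutionOfSingularities.ResolutionOfSingularities.Theorems.WildQuotientResolution.ConductorOne

section Reflect

variable {A : Type*} [CommRing A]

/-- `reflect N` is an involution (no degree hypothesis: `revAt N` is). [folklore] -/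
theorem reflect_reflect' (N : ℕ) (f : A[X]) : reflect N (reflect N f) = f := by
  ext i
  rw [coeff_reflect, coeff_reflect, revAt_invol]

/-- `reflect N` is additive over finite sums. [folklore] -/
theorem reflect_sum {ι : Type*} (N : ℕ) (t : Finset ι) (f : ι → A[X]) :
    reflect N (∑ i ∈ t, f i) = ∑ i ∈ t, reflect N (f i) := by
  classical
  induction t using Finset.induction_on with
  | empty => simp [reflect_zero]
  | insert a t ha ih => rw [Finset.sum_insert ha, Finset.sum_insert ha, reflect_add, ih]

/-- Raising the reflection level multiplies by a power of `X`. [folklore] -/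
theorem reflect_add_level (D e : ℕ) (f : A[X]) (hf : f.natDegree ≤ D) :
    reflect (D + e) f = reflect D f * X ^ e := by
  have h := reflect_mul f (1 : A[X]) (F := D) (G := e) hf (by simp)
  rwa [mul_one, reflect_one] at h

/-- `natDegree (1 + X) ≤ 1`. [folklore] -/
theorem natDegree_one_add_X_le : (1 + X : A[X]).natDegree ≤ 1 :=
  (natDegree_add_le _ _).trans (max_le (by simp) natDegree_X_le)

/-- `natDegree ((1 + X)^m) ≤ m`. [folklore] -/
theorem natDegree_one_add_X_pow_le (m : ℕ) : ((1 + X : A[X]) ^ m).natDegree ≤ m :=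
  natDegree_pow_le.trans (by
    calc m * (1 + X : A[X]).natDegree ≤ m * 1 := Nat.mul_le_mul_left m natDegree_one_add_X_le
      _ = m := mul_one m)

/-- `reflect 1 X = 1`. [folklore] -/
theorem reflect_one_X : reflect 1 (X : A[X]) = 1 := by
  have h := reflect_monomial (R := A) 1 1
  rwa [pow_one, revAt_le le_rfl, Nat.sub_self, pow_zero] at h

/-- `reflect m ((1+X)^m) = (1+X)^m`. [folklore] -/
theorem reflect_one_add_X_pow (m : ℕ) : reflect m ((1 + X : A[X]) ^ m) = (1 + X) ^ m := by
  induction m with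
  | zero => simp
  | succ m ih =>
    have h1 : reflect 1 (1 + X : A[X]) = 1 + X := by
      rw [reflect_add, reflect_one, pow_one, reflect_one_X, add_comm]
    rw [pow_succ, reflect_mul _ _ (natDegree_one_add_X_pow_le m) natDegree_one_add_X_le, ih, h1]

/-- `reflect N (X^N) = 1`. [folklore] -/
theorem reflect_X_pow_self (N : ℕ) : reflect N ((X : A[X]) ^ N) = 1 := by
  rw [reflect_monomial, revAt_le le_rfl, Nat.sub_self, pow_zero]

/-- **The twisted substitution** `Φ_D(P) = ∑_{i ≤ D} Pᵢ · Xⁱ · (1+X)^{D−i}` (the polynomial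
`(1+s)^D · P(s/(1+s))`). [OURS · L1 W4.5c] -/
def twistSubst (D : ℕ) (P : A[X]) : A[X] :=
  ∑ i ∈ Finset.range (D + 1), C (P.coeff i) * X ^ i * (1 + X) ^ (D - i)

/-- `natDegree (Φ_D P) ≤ D`. [OURS · L1 W4.5c] -/
theorem natDegree_twistSubst_le (D : ℕ) (P : A[X]) : (twistSubst D P).natDegree ≤ D := by
  unfold twistSubst
  refine natDegree_sum_le_of_forall_le _ _ fun i hi => ?_
  have hi' : i ≤ D := Nat.lt_succ_iff.mp (Finset.mem_range.mp hi)
  calc (C (P.coeff i) * X ^ i * (1 + X) ^ (D - i)).natDegree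
      ≤ (C (P.coeff i) * X ^ i).natDegree + ((1 + X : A[X]) ^ (D - i)).natDegree :=
        natDegree_mul_le
    _ ≤ i + (D - i) := by
        gcongr
        · exact (natDegree_C_mul_le _ _).trans (natDegree_X_pow_le i)
        · exact natDegree_one_add_X_pow_le (D - i)
    _ = D := by omega

/-- **Reflection of the twisted substitution**: `reflect D (Φ_D P) = (reflect D P).comp (X + 1)` for
`natDegree P ≤ D`. [OURS · L1 W4.5c] -/
theorem reflect_twistSubst (D : ℕ) (P : A[X]) (hP : P.natDegree ≤ D) :
    reflect D (twistSubst D P) = (reflect D P).comp (X + 1) := by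
  -- left side, term by term
  have hL : reflect D (twistSubst D P) =
      ∑ i ∈ Finset.range (D + 1), C (P.coeff i) * (1 + X) ^ (D - i) := by
    unfold twistSubst
    rw [reflect_sum]
    refine Finset.sum_congr rfl fun i hi => ?_
    have hi' : i ≤ D := Nat.lt_succ_iff.mp (Finset.mem_range.mp hi)
    have hdegX : ((X : A[X]) ^ i).natDegree ≤ i := natDegree_X_pow_le i
    have hdeg1 : ((1 + X : A[X]) ^ (D - i)).natDegree ≤ D - i := natDegree_one_add_X_pow_le (D - i)
    have hmul := reflect_mul ((X : A[X]) ^ i) ((1 + X) ^ (D - i)) hdegX hdeg1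
    rw [Nat.add_sub_cancel' hi'] at hmul
    rw [mul_assoc, reflect_C_mul, hmul, reflect_X_pow_self, one_mul, reflect_one_add_X_pow]
  -- right side: `reflect D P = ∑ Pᵢ X^{D-i}`
  have hR : reflect D P = ∑ i ∈ Finset.range (D + 1), C (P.coeff i) * X ^ (D - i) := by
    conv_lhs => rw [P.as_sum_range' (D + 1) (Nat.lt_succ_of_le hP)]
    rw [reflect_sum]
    refine Finset.sum_congr rfl fun i hi => ?_
    have hi' : i ≤ D := Nat.lt_succ_iff.mp (Finset.mem_range.mp hi)
    rw [← C_mul_X_pow_eq_monomial, reflect_C_mul_X_pow, revAt_le hi']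
  rw [hL, hR, Polynomial.sum_comp]
  refine Finset.sum_congr rfl fun i _ => ?_
  rw [mul_comp, C_comp, X_pow_comp, add_comm]

/-- `reflect p (X^p − X) = 1 − X^{p−1}` (`1 ≤ p`). [OURS · L1 W4.5c] -/
theorem reflect_artinSchreier (p : ℕ) (hp : 1 ≤ p) :
    reflect p ((X : A[X]) ^ p - X) = 1 - X ^ (p - 1) := by
  rw [reflect_sub, reflect_X_pow_self, ← pow_one (X : A[X]), reflect_monomial, revAt_le hp,
    pow_one]

/-- `reflect (p·d) ((X^p − X)^d) = (1 − X^{p−1})^d`. [OURS · L1 W4.5c] -/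
theorem reflect_artinSchreier_pow (p : ℕ) (hp : 1 ≤ p) (d : ℕ) :
    reflect (p * d) (((X : A[X]) ^ p - X) ^ d) = (1 - X ^ (p - 1)) ^ d := by
  induction d with
  | zero => simp
  | succ d ih =>
    have hdeg1 : ((X : A[X]) ^ p - X).natDegree ≤ p :=
      (natDegree_sub_le _ _).trans (max_le (natDegree_X_pow_le p) (natDegree_X_le.trans hp))
    have hdeg : (((X : A[X]) ^ p - X) ^ d).natDegree ≤ p * d :=
      natDegree_pow_le.trans (by
        calc d * ((X : A[X]) ^ p - X).natDegree ≤ d * p := Nat.mul_le_mul_left d hdeg1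
          _ = p * d := mul_comm d p)
    rw [pow_succ, Nat.mul_succ, reflect_mul _ _ hdeg hdeg1, ih, reflect_artinSchreier p hp, pow_succ]

end Reflect

section Twisted

variable {A : Type} [CommRing A] (p : ℕ) [Fact p.Prime] [CharP A p]

/-- `X` and `X + 1` are coprime. [folklore] -/
theorem isCoprime_X_X_add_one : IsCoprime (X : A[X]) (X + 1) :=
  ⟨-1, 1, by ring⟩

/-- **Twisted translation invariants**: if `X^N · R(X+1) = (X+1)^N · R(X)` then
`R = X^N · Q(X^p − X)` for some `Q` (Artin–Schreier on the untwisted quotient `R/X^N`).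
[OURS · L1 W4.5c] -/
theorem exists_eq_X_pow_mul_of_twisted_translate (N : ℕ) (R : A[X])
    (hR : X ^ N * R.comp (X + 1) = (X + 1) ^ N * R) :
    ∃ Q : A[X], R = X ^ N * aeval (X ^ p - X : A[X]) Q := by
  -- `X^N ∣ R`
  have hcop : IsCoprime ((X : A[X]) ^ N) ((X + 1) ^ N) := (isCoprime_X_X_add_one).pow
  have hdvd : (X : A[X]) ^ N ∣ (X + 1) ^ N * R := ⟨R.comp (X + 1), hR.symm⟩
  obtain ⟨R₀, rfl⟩ := hcop.dvd_of_dvd_mul_left hdvd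
  -- `R₀` is translation invariant
  have hcomp : (X ^ N * R₀).comp (X + 1) = (X + 1) ^ N * R₀.comp (X + 1) := by
    rw [mul_comp, X_pow_comp]
  rw [hcomp, ← mul_assoc, ← mul_assoc, mul_comm ((X : A[X] ) ^ N) ((X + 1) ^ N)] at hR
  have hreg : IsLeftRegular (((X : A[X]) + 1) ^ N * X ^ N) :=
    ((monic_X_add_C (1 : A)).pow N |>.mul (monic_X_pow N)).isRegular.left
  have hinv : R₀.comp (X + 1) = R₀ := hreg hR
  -- Artin–Schreier (tree lemma B1, `ρ = 1`)
  have hfix : Polynomial.algEquivAevalXAddC (1 : A) R₀ = R₀ := by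
    rw [ToricExit.algEquivAevalXAddC_eq_taylor, taylor_apply, map_one]
    exact hinv
  have hmem := (ToricExit.fixedPoints_translate p A 1 (one_mem _) R₀).mp hfix
  obtain ⟨Q, hQ⟩ := hmem
  have hQ' : aeval (X ^ p - X : A[X]) Q = R₀ := by
    rw [one_pow, map_one, one_mul] at hQ
    exact hQ
  exact ⟨Q, by rw [hQ']⟩

/-- Degree of `Q(X^p − X)`: `natDegree = p · natDegree Q` (the inner polynomial is monic of degree
`p ≥ 2`). [folklore] -/
theorem natDegree_aeval_artinSchreier (Q : A[X]) :
    (aeval (X ^ p - X : A[X]) Q).natDegree = p * Q.natDegree := by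
  haveI : Nontrivial A := CharP.nontrivial_of_char_ne_one (R := A) (Fact.out : p.Prime).ne_one
  have hp : 2 ≤ p := (Fact.out : p.Prime).two_le
  have hmonic : ((X : A[X]) ^ p - X).Monic := by
    apply monic_X_pow_sub
    rw [degree_X]; exact_mod_cast (by omega : 1 < p)
  have hdeg : ((X : A[X]) ^ p - X).natDegree = p := by
    rw [natDegree_sub_eq_left_of_natDegree_lt, natDegree_X_pow]
    rw [natDegree_X_pow, natDegree_X]; omega
  by_cases hQ : Q = 0
  · subst hQ; simp
  rw [← comp_eq_aeval, natDegree_comp_eq_of_mul_ne_zero, hdeg, mul_comm]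
  rw [hmonic.leadingCoeff, one_pow, mul_one]
  exact leadingCoeff_ne_zero.mpr hQ

/-- **The normal form.** If `natDegree P ≤ p·m` and `Φ_{pm}(P) = (1+X)^N · P`, then
`P = ∑_{d ≤ D} q_d · X^{pm − N − pd} · (1 − X^{p−1})^d` with `N + p·D ≤ p·m` (the hypothesis
`N ≤ p·m` is automatic for `P ≠ 0` and can always be arranged by enlarging `m`). [OURS · L1 W4.5c] -/
theorem exists_normalForm_of_twistSubst_eq (P : A[X]) (m N : ℕ) (hP : P.natDegree ≤ p * m)
    (hN : N ≤ p * m) (h : twistSubst (p * m) P = (1 + X) ^ N * P) :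
    ∃ (D : ℕ) (q : ℕ → A), N + p * D ≤ p * m ∧
      P = ∑ d ∈ Finset.range (D + 1), C (q d) * X ^ (p * m - N - p * d) * (1 - X ^ (p - 1)) ^ d := by
  have hp1 : 1 ≤ p := (Fact.out : p.Prime).one_le
  -- reflect at level `pm + N`
  set R : A[X] := reflect (p * m) P with hRdef
  have hRdeg : R.natDegree ≤ p * m := natDegree_reflect_le.trans (max_le le_rfl hP)
  have hNdeg : ((1 + X : A[X]) ^ N).natDegree ≤ N := natDegree_one_add_X_pow_le N
  have hrefl := congrArg (reflect (N + p * m)) h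
  rw [add_comm N (p * m), reflect_add_level _ _ _ (natDegree_twistSubst_le _ _),
    reflect_twistSubst _ _ hP, add_comm (p * m) N, reflect_mul _ _ hNdeg hP,
    reflect_one_add_X_pow] at hrefl
  -- `hrefl : R.comp (X+1) * X^N = (1+X)^N * R`
  have hTW : X ^ N * R.comp (X + 1) = (X + 1) ^ N * R := by
    rw [mul_comm, hrefl, add_comm]
  obtain ⟨Q, hQ⟩ := exists_eq_X_pow_mul_of_twisted_translate p N R hTW
  -- degree bound
  by_cases hQ0 : Q = 0
  · refine ⟨0, fun _ => 0, by omega, ?_⟩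
    have hR0 : R = 0 := by rw [hQ, hQ0, map_zero, mul_zero]
    have hP0 : P = 0 := by
      rw [← reflect_reflect' (p * m) P, ← hRdef, hR0, reflect_zero]
    simp [hP0]
  have hdegQ : N + p * Q.natDegree ≤ p * m := by
    haveI : Nontrivial A := CharP.nontrivial_of_char_ne_one (R := A) (Fact.out : p.Prime).ne_one
    have hx : ((X : A[X]) ^ N * aeval (X ^ p - X : A[X]) Q).natDegree = N + p * Q.natDegree := by
      rw [(monic_X_pow N).natDegree_mul', natDegree_X_pow, natDegree_aeval_artinSchreier p Q]
      -- `aeval (X^p − X) Q ≠ 0` since its natDegree is `p · natDegree Q` and `Q ≠ 0`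
      intro h0
      apply hQ0
      by_cases hd : Q.natDegree = 0
      · rw [eq_C_of_natDegree_eq_zero hd, aeval_C, algebraMap_eq] at h0
        rw [eq_C_of_natDegree_eq_zero hd, C_eq_zero.mp h0, C_0]
      · exfalso
        have hdeg := natDegree_aeval_artinSchreier p Q
        rw [h0, natDegree_zero] at hdeg
        have hp2 := (Fact.out : p.Prime).two_le
        rcases Nat.mul_eq_zero.mp hdeg.symm with h | h <;> omega
    rw [← hx, ← hQ]; exact hRdeg
  refine ⟨Q.natDegree, fun d => Q.coeff d, hdegQ, ?_⟩
  -- reflect back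
  have hPR : P = reflect (p * m) R := by rw [hRdef, reflect_reflect']
  rw [hPR, hQ]
  -- expand `Q(X^p − X)` as a sum
  have hQsum : aeval (X ^ p - X : A[X]) Q =
      ∑ d ∈ Finset.range (Q.natDegree + 1), C (Q.coeff d) * (X ^ p - X) ^ d := by
    conv_lhs => rw [Q.as_sum_range' (Q.natDegree + 1) (Nat.lt_succ_self _)]
    rw [map_sum]
    refine Finset.sum_congr rfl fun d _ => ?_
    rw [aeval_monomial, algebraMap_eq]
  rw [hQsum, Finset.mul_sum, reflect_sum]
  refine Finset.sum_congr rfl fun d hd => ?_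
  have hd' : d ≤ Q.natDegree := Nat.lt_succ_iff.mp (Finset.mem_range.mp hd)
  have hle : N + p * d ≤ p * m := le_trans (by gcongr) hdegQ
  have hdeg1 : ((X : A[X]) ^ p - X).natDegree ≤ p :=
    (natDegree_sub_le _ _).trans (max_le (natDegree_X_pow_le p) (natDegree_X_le.trans hp1))
  have hdegd : (((X : A[X]) ^ p - X) ^ d).natDegree ≤ p * d :=
    natDegree_pow_le.trans (by
      calc d * ((X : A[X]) ^ p - X).natDegree ≤ d * p := Nat.mul_le_mul_left d hdeg1
        _ = p * d := mul_comm d p)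
  have hdegCd : (C (Q.coeff d) * ((X : A[X]) ^ p - X) ^ d).natDegree ≤ p * d :=
    (natDegree_C_mul_le _ _).trans hdegd
  have hsplit : p * m = (N + p * d) + (p * m - N - p * d) := by omega
  have hlev : reflect (p * m) (X ^ N * (C (Q.coeff d) * (X ^ p - X) ^ d)) =
      reflect ((N + p * d) + (p * m - N - p * d)) (X ^ N * (C (Q.coeff d) * (X ^ p - X) ^ d)) := by
    rw [← hsplit]
  rw [hlev, reflect_add_level _ _ _ (natDegree_mul_le.trans (add_le_add (natDegree_X_pow_le N) hdegCd)),
    reflect_mul _ _ (natDegree_X_pow_le N) hdegCd, reflect_X_pow_self, one_mul, reflect_C_mul,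
    reflect_artinSchreier_pow p hp1]
  ring


/-- **The normal form at an arbitrary level `L`** (same statement and proof as
`exists_normalForm_of_twistSubst_eq` with `p·m` replaced by any level `L ≥ natDegree P`; needed
by the presentation brick, where the level `E + pt − |m_K| + |m_J|` of a graded slice is not a
multiple of `p`). [OURS · L1 W4.5c] -/
theorem exists_normalForm_of_twistSubst_eq_level (P : A[X]) (L N : ℕ) (hP : P.natDegree ≤ L)
    (hN : N ≤ L) (h : twistSubst L P = (1 + X) ^ N * P) :
    ∃ (D : ℕ) (q : ℕ → A), N + p * D ≤ L ∧
      P = ∑ d ∈ Finset.range (D + 1), C (q d) * X ^ (L - N - p * d) * (1 - X ^ (p - 1)) ^ d := by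
  have hp1 : 1 ≤ p := (Fact.out : p.Prime).one_le
  -- reflect at level `pm + N`
  set R : A[X] := reflect (L) P with hRdef
  have hRdeg : R.natDegree ≤ L := natDegree_reflect_le.trans (max_le le_rfl hP)
  have hNdeg : ((1 + X : A[X]) ^ N).natDegree ≤ N := natDegree_one_add_X_pow_le N
  have hrefl := congrArg (reflect (N + L)) h
  rw [add_comm N (L), reflect_add_level _ _ _ (natDegree_twistSubst_le _ _),
    reflect_twistSubst _ _ hP, add_comm (L) N, reflect_mul _ _ hNdeg hP,
    reflect_one_add_X_pow] at hrefl
  -- `hrefl : R.comp (X+1) * X^N = (1+X)^N * R`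
  have hTW : X ^ N * R.comp (X + 1) = (X + 1) ^ N * R := by
    rw [mul_comm, hrefl, add_comm]
  obtain ⟨Q, hQ⟩ := exists_eq_X_pow_mul_of_twisted_translate p N R hTW
  -- degree bound
  by_cases hQ0 : Q = 0
  · refine ⟨0, fun _ => 0, by omega, ?_⟩
    have hR0 : R = 0 := by rw [hQ, hQ0, map_zero, mul_zero]
    have hP0 : P = 0 := by
      rw [← reflect_reflect' (L) P, ← hRdef, hR0, reflect_zero]
    simp [hP0]
  have hdegQ : N + p * Q.natDegree ≤ L := by
    haveI : Nontrivial A := CharP.nontrivial_of_char_ne_one (R := A) (Fact.out : p.Prime).ne_one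
    have hx : ((X : A[X]) ^ N * aeval (X ^ p - X : A[X]) Q).natDegree = N + p * Q.natDegree := by
      rw [(monic_X_pow N).natDegree_mul', natDegree_X_pow, natDegree_aeval_artinSchreier p Q]
      -- `aeval (X^p − X) Q ≠ 0` since its natDegree is `p · natDegree Q` and `Q ≠ 0`
      intro h0
      apply hQ0
      by_cases hd : Q.natDegree = 0
      · rw [eq_C_of_natDegree_eq_zero hd, aeval_C, algebraMap_eq] at h0
        rw [eq_C_of_natDegree_eq_zero hd, C_eq_zero.mp h0, C_0]
      · exfalso
        have hdeg := natDegree_aeval_artinSchreier p Q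
        rw [h0, natDegree_zero] at hdeg
        have hp2 := (Fact.out : p.Prime).two_le
        rcases Nat.mul_eq_zero.mp hdeg.symm with h | h <;> omega
    rw [← hx, ← hQ]; exact hRdeg
  refine ⟨Q.natDegree, fun d => Q.coeff d, hdegQ, ?_⟩
  -- reflect back
  have hPR : P = reflect (L) R := by rw [hRdef, reflect_reflect']
  rw [hPR, hQ]
  -- expand `Q(X^p − X)` as a sum
  have hQsum : aeval (X ^ p - X : A[X]) Q =
      ∑ d ∈ Finset.range (Q.natDegree + 1), C (Q.coeff d) * (X ^ p - X) ^ d := by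
    conv_lhs => rw [Q.as_sum_range' (Q.natDegree + 1) (Nat.lt_succ_self _)]
    rw [map_sum]
    refine Finset.sum_congr rfl fun d _ => ?_
    rw [aeval_monomial, algebraMap_eq]
  rw [hQsum, Finset.mul_sum, reflect_sum]
  refine Finset.sum_congr rfl fun d hd => ?_
  have hd' : d ≤ Q.natDegree := Nat.lt_succ_iff.mp (Finset.mem_range.mp hd)
  have hle : N + p * d ≤ L := le_trans (by gcongr) hdegQ
  have hdeg1 : ((X : A[X]) ^ p - X).natDegree ≤ p :=
    (natDegree_sub_le _ _).trans (max_le (natDegree_X_pow_le p) (natDegree_X_le.trans hp1))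
  have hdegd : (((X : A[X]) ^ p - X) ^ d).natDegree ≤ p * d :=
    natDegree_pow_le.trans (by
      calc d * ((X : A[X]) ^ p - X).natDegree ≤ d * p := Nat.mul_le_mul_left d hdeg1
        _ = p * d := mul_comm d p)
  have hdegCd : (C (Q.coeff d) * ((X : A[X]) ^ p - X) ^ d).natDegree ≤ p * d :=
    (natDegree_C_mul_le _ _).trans hdegd
  have hsplit : L = (N + p * d) + (L - N - p * d) := by omega
  have hlev : reflect (L) (X ^ N * (C (Q.coeff d) * (X ^ p - X) ^ d)) =
      reflect ((N + p * d) + (L - N - p * d)) (X ^ N * (C (Q.coeff d) * (X ^ p - X) ^ d)) := by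
    rw [← hsplit]
  rw [hlev, reflect_add_level _ _ _ (natDegree_mul_le.trans (add_le_add (natDegree_X_pow_le N) hdegCd)),
    reflect_mul _ _ (natDegree_X_pow_le N) hdegCd, reflect_X_pow_self, one_mul, reflect_C_mul,
    reflect_artinSchreier_pow p hp1]
  ring

end Twisted

end Summit.ResolutionOfSingularities.ResolutionOfSingularities.Theorems.WildQuotientResolution.ConductorOne

end
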